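import Summits.BirchSwinnertonDyer.BirchSwinnertonDyer.Theses.AdditiveKolyvaginRoad
import Summits.BirchSwinnertonDyer.BirchSwinnertonDyer.Theorems.AdditiveKolyvaginRoadManinFrameTransport
import HarnessLib

/-!
# Route `AdditiveKolyvaginRoad`, support item `ManinFrameResidueDegreeClass`: the Manin-residue
# frame on the DEGREE sub-locus of the isogeny class, modulo Česnavičius–Neururer–Saha by name

Cell `pub/bsd-wall` (D-0120, W-ALL lane 3, row 2), seat `bsd-wall-akr-p2` (prover, g4). THEOREMS
ONLY (no definition, no named fact, no `sorry`); nothing is booked. This thin file imports the route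
file (for the decl name) and the route-independent machinery
`AdditiveKolyvaginRoadManinFrameTransport.lean` (p521337, §3); no Theorems module importing the
route is imported (theses-cone hygiene).

WHAT THE ITEM ASKS. The second resplit of the crux `ManinGoodOddFrameAdditive`
(stmt-BirchSwinnertonDyer-20136) carves the Česnavičius–Neururer–Saha DEGREE sub-locus out of the
Manin residue: for an AKR frame `(W, p)` (`W/ℚ` globally minimal, `p ≥ 5`, additive at `p`, `E[p]`
irreducible, the residue clause, `r_an = 1`) such that SOME globally minimal `W' ∼ W` carries a
parametrisation datum `D'` at level `N(W)` with `p ∤ deg D'`, the 9-conjunct Manin-good odd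
Heegner frame datum exists — modulo the antecedents `cesnaviciusNeururerSaha_padicVal_maninConstant_le_modularDegree`
(ČNS 2024 Thm. 1.2, a PUBLISHED theorem taken by name) and `PublishedInputsAdditiveKoly` (only
Modularity, conjunct 6, and Hoffstein–Luo, conjunct 7, are used).

PROOF. `ManinFrameTransport.exists_oddHeegnerFrame_of_not_dvd_modularDegree` (p521337 §3): ČNS gives
`p ∤ c(D')`, the prime-to-`p` transport under `Irr` moves the datum to `W`
(`exists_modularParametrizationData_not_dvd_of_partner`), and
`ManinFrameFromDatum.exists_oddHeegnerFrame_of_exists_not_dvd` (p512355) builds the Hoffstein–Luo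
frame at odd `p`. The `Addv` hypothesis and the residue clause are not used (the degree reading is
uniform in the reduction type).

References: [CesnaviciusNeururerSaha2023] JEMS 26 (2024) 573–637, Thm. 1.2; [HoffsteinLuo1997]
Theorem (§1); [Darmon2004] Thm. 3.6.
-/

set_option autoImplicit false
-- the Theorems directory repeats the summit name (sibling precedent `SignedBaseChangeAssembly.lean`)
set_option linter.dupNamespace false

namespace Summit.BirchSwinnertonDyer.BirchSwinnertonDyer.Theorems.ManinFrameResidueDegreeClass

open Summit.BirchSwinnertonDyer.BirchSwinnertonDyer.Theses.AdditiveKolyvaginRoad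

/-- **`ManinFrameResidueDegreeClass` — the route decl BY NAME** (conditional only on its own displayed
antecedents ČNS-by-name and `PublishedInputsAdditiveKoly`): on the degree sub-locus of the class
(some globally minimal `W' ∼ W` with a level-`N(W)` parametrisation datum of modular degree prime to
`p`), the 9-conjunct Manin-good odd Heegner frame of `W` exists, by
`ManinFrameTransport.exists_oddHeegnerFrame_of_not_dvd_modularDegree`.
[cite: CesnaviciusNeururerSaha2023, Thm. 1.2] [cite: HoffsteinLuo1997, Theorem (§1)]
[cite: Darmon2004, Thm. 3.6] -/
theorem maninFrameResidueDegreeClass_proof : ManinFrameResidueDegreeClass := by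
  intro hCNS hPub W _ _ p _ _ hp5 _hadd hirr _hres hdeg hr
  obtain ⟨W', hW', hW'min, D', hiso, hdeg⟩ := hdeg
  haveI := hW'
  haveI := hW'min
  exact ManinFrameTransport.exists_oddHeegnerFrame_of_not_dvd_modularDegree hPub.2.2.2.2.2.1
    hPub.2.2.2.2.2.2.1 hCNS W p hr hp5 hirr hiso D' hdeg

end Summit.BirchSwinnertonDyer.BirchSwinnertonDyer.Theorems.ManinFrameResidueDegreeClass
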